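import Mathlib
import Literature.Computability.Complexity.RangeAvoidance
import Literature.Computability.Complexity.SignDegreeXor
import Summits.PneNP.PneNP.Theorems.PstarSALevel
import Summits.PneNP.PneNP.Theorems.PstarSASDPLevel
import Summits.PneNP.PneNP.Theorems.PstarSAClosure
import Summits.PneNP.PneNP.Theorems.PstarExpandingModel

/-!
# Random pure `IP₃` instances, I: the model and the bad-set containment (cell `pnp-ideate`, ROUND-22 item T22.2)

FRONTIER range-avoidance ladder, rung F-N3 context (restricted-model combinatorics — nothing here bears on `P` vs `NP`).  Towards
the EXISTENCE of `(n/c, 7/2)`-boundary-expanding pure `IP₃ = u₀u₁ ⊕ u₂u₃ ⊕ u₄u₅` instances at every linear stretch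
(`ExpandingIP3Exist`, the existence input of the ROUND-22 headline COR-A), by the first-moment method done as counting — the
`k = 6` analogue of `PstarExpandingModel`/`Count`/`Exist`:

* the model: an outcome `ω : Fin m → (Fin 6 ↪ Fin N)` gives the pure instance `inst6 ω` (output `j` reads the six distinct
  positions `ω j`); `isPure_inst6`;
* `boundaryExpandingQ_of_vertexExpanding6`: `(∀ |J| ≤ r, 19·|J| ≤ 4·|N(J)|) ⇒ BoundaryExpandingQ 7 2 r` (from
  `PstarExpandingModel.two_card_nbhd_le` at `k = 6`);
* `embIn A` (embeddings with range inside `A`), `card_embIn_le` (`≤ |A|⁶`), and `exists_set_of_small_nbhd6` (if `|N(J)| ≤ v ≤ N`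
  then some `A` with `|A| = v` contains the positions of every output of `J`).
-/

set_option linter.dupNamespace false

open Finset Literature.Computability.Complexity
open Summit.PneNP.PneNP.Theorems.PstarSALevel (varSet bdry)
open Summit.PneNP.PneNP.Theorems.PstarSASDPLevel (BoundaryExpandingQ)
open Summit.PneNP.PneNP.Theorems.PstarSAClosure (nbhd mem_nbhd)
open Summit.PneNP.PneNP.Theorems.PstarExpandingModel (two_card_nbhd_le)

namespace Summit.PneNP.PneNP.Theorems.IP3ExpandingModel

variable {N m : ℕ}

/-- An outcome: for every output an injective `6`-tuple of positions. -/
abbrev Outcome6 (N m : ℕ) : Type := Fin m → (Fin 6 ↪ Fin N)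

/-- **The instance of an outcome**: pure `IP₃` on `N` variables. -/
def inst6 (ω : Outcome6 N m) : LocalMap 6 N m where
  vars j := ω j
  table _ := ipPred 3

/-- The instance of an outcome is pure `IP₃`. -/
theorem isPure_inst6 (ω : Outcome6 N m) : (inst6 ω).IsPure (ipPred 3) := ⟨fun _ => rfl, fun j => (ω j).injective⟩

/-- **Vertex expansion ⇒ `(r, 7/2)`-boundary expansion** for `6`-local instances with injective positions. -/
theorem boundaryExpandingQ_of_vertexExpanding6 (I : LocalMap 6 N m) (hI : ∀ j, Function.Injective (I.vars j)) (r : ℕ)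
    (h : ∀ J : Finset (Fin m), J.card ≤ r → 19 * J.card ≤ 4 * (nbhd I J).card) : BoundaryExpandingQ 7 2 r I := by
  intro J hJ
  have h1 := h J hJ
  have h2 := two_card_nbhd_le I hI J
  omega

/-- `N(J)` of the instance: the union of the ranges of the tuples. -/
theorem mem_nbhd_inst6 (ω : Outcome6 N m) (J : Finset (Fin m)) (v : Fin N) :
    v ∈ nbhd (inst6 ω) J ↔ ∃ j ∈ J, ∃ s : Fin 6, ω j s = v := by
  simp only [PstarSAClosure.nbhd, PstarSALevel.varSet, Finset.mem_biUnion, Finset.mem_image, Finset.mem_univ, true_and]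
  rfl

/-- The embeddings whose range lies inside `A`. -/
noncomputable def embIn (A : Finset (Fin N)) : Finset (Fin 6 ↪ Fin N) := univ.filter fun e => ∀ s, e s ∈ A

/-- `|embIn A| ≤ |A|⁶`. -/
theorem card_embIn_le (A : Finset (Fin N)) : (embIn A).card ≤ A.card ^ 6 := by
  classical
  have h : (embIn A).card ≤ (Fintype.piFinset fun _ : Fin 6 => A).card := by
    refine Finset.card_le_card_of_injOn (fun e => (e : Fin 6 → Fin N)) ?_ ?_
    · intro e he
      simp only [embIn, Finset.coe_filter, Set.mem_setOf_eq, Finset.mem_univ, true_and] at he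
      rw [Finset.mem_coe, Fintype.mem_piFinset]
      exact he
    · intro e _ e' _ h
      exact DFunLike.coe_injective h
  refine h.trans ?_
  rw [Fintype.card_piFinset, Finset.prod_const, Finset.card_univ, Fintype.card_fin]

/-- **Containment.**  If `|N(J)| ≤ v ≤ N` then some `A ⊆ Fin N` with `|A| = v` contains every position of every output of `J`. -/
theorem exists_set_of_small_nbhd6 (ω : Outcome6 N m) (J : Finset (Fin m)) (v : ℕ) (hvN : v ≤ N)
    (h : (nbhd (inst6 ω) J).card ≤ v) : ∃ A : Finset (Fin N), A.card = v ∧ ∀ j ∈ J, ω j ∈ embIn A := by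
  obtain ⟨A, hXA, -, hA⟩ := Finset.exists_subsuperset_card_eq (Finset.subset_univ (nbhd (inst6 ω) J)) h (by simp; omega)
  refine ⟨A, hA, fun j hj => ?_⟩
  simp only [embIn, Finset.mem_filter, Finset.mem_univ, true_and]
  intro s
  exact hXA ((mem_nbhd_inst6 ω J _).2 ⟨j, hj, s, rfl⟩)

end Summit.PneNP.PneNP.Theorems.IP3ExpandingModel
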